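import Mathlib.Analysis.Distribution.SchwartzSpace.Fourier
import Mathlib.Analysis.InnerProductSpace.PiL2
import Literature.MathematicalPhysics.QuantumLattice.WightmanAxioms
import Literature.MathematicalPhysics.QuantumLattice.SchwingerWightman
import Literature.MathematicalPhysics.QuantumLattice.SchwartzTensor
import Literature.MathematicalPhysics.QuantumLattice.MinkowskiGeometry
import Literature.MathematicalPhysics.QuantumLattice.EuclideanAction
import HarnessLib

-- provenance: harness21/H21/H21/Prelude/AnalysisL/WightmanFunctions.lean @ 391abd3 (interim HEAD d8f2665); M5 mechanical rewrite
/-!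
# Wightman distributions, Wightman reconstruction and the Reeh–Schlieder theorem

Trunk `AnalysisL` (G28), item P3 / notions `wightman_axioms`,
`schwinger_wightman_correspondence`.

The vacuum expectation values of a Wightman QFT (`IsWightmanQFT W`, accepted module
`WightmanAxioms`) define, by the Schwartz nuclear (kernel) theorem, tempered distributions
`𝒲ₙ ∈ 𝒮'((ℝ^{1+d})^n)` — one for each `n` and each choice of field labels `k : Fin n → κ` —
with `𝒲ₙ(f₁ ⊗ ⋯ ⊗ fₙ) = ⟪Ω, φ_{k₁}(f₁) ⋯ φ_{kₙ}(fₙ) Ω⟫` (accepted `IsWightmanDistributionOf`).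
Streater–Wightman §3-3/§3-4 list their characteristic properties:

* (a) relativistic (Poincaré) invariance, `IsPoincareInvariantFamily`;
* (b) the spectral condition (support of the Fourier transform), `HasSpectralCondition`;
* (c) hermiticity, `IsHermitianFamily`;
* (d) local commutativity, `IsLocalFamily`;
* (e) positive definiteness (Wightman positivity), `IsPositiveDefiniteFamily`;
* (f) the cluster decomposition property, `HasClusterProperty`;
* and the normalisation `𝒲₀ = 1`, `IsNormalisedFamily`;

bundled as `structure IsWightmanFamily 𝒲 : Prop`. The main theorems (all known, proofs `sorry`):

* `IsWightmanQFT.existsUnique_wightmanFamily` — the Wightman distributions of a Wightman QFT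
  exist and are unique (kernel theorem; SW Thm. 2-1, §3-3);
* `IsWightmanQFT.isWightmanFamily` — they have properties (a)–(f) (SW Thms. 3-1 – 3-4);
* `wightman_reconstruction` — the **Wightman reconstruction theorem** (SW Thm. 3-7): a family
  with properties (a)–(f) is the family of Wightman distributions of a Wightman QFT on the
  polynomial domain `D₀` (`WightmanData.HasMinimalDomain`), unique up to unitary equivalence
  among such QFTs;
* `reeh_schlieder` — the **Reeh–Schlieder theorem** (SW Thm. 4-2): field polynomials smeared
  with `𝒟(O)` test functions, `O` any nonempty open region, already generate a dense subspace
  from the vacuum;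
* `IsWightmanFamily.translation_invariant` — translation invariance from (a) (real proof).

## Sources

* R. F. Streater, A. S. Wightman, *PCT, Spin and Statistics, and All That* (1964), §2-1
  (Thm. 2-1, Schwartz nuclear theorem), §3-3 (eqs. (3-11)–(3-13), (3-21), (3-25)–(3-27)),
  §3-4 (eqs. (3-29)–(3-31), Thm. 3-7, reconstruction), §4-2 (Thm. 4-2, Reeh–Schlieder).
* R. Jost, *The General Theory of Quantized Fields* (1965), ch. III–IV.
* H. Reeh, S. Schlieder, *Bemerkungen zur Unitäräquivalenz von Lorentzinvarianten Feldern*,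
  Nuovo Cimento 22 (1961) 1051–1068.

## Mathlib

Used: the Schwartz space `𝓢(E, ℂ)` and `SchwartzMap.compCLMOfContinuousLinearEquiv`, the
Fourier transform on Schwartz space `SchwartzMap.fourierTransformCLM` (which needs a
finite-dimensional real inner-product domain with its Borel σ-algebra — hence the flattening
`flattenCLE : (Fin n → SpaceTime d) ≃L[ℝ] EuclideanSpace ℝ (Fin n × Fin (d + 1))`, built from
`LinearEquiv.curry`, `WithLp.linearEquiv` and `LinearEquiv.toContinuousLinearEquiv`),
`tsupport`, `Fin.revPerm`, `Equiv.swap`, `Fin.append`, `Filter.Tendsto`, `Submodule.span`,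
`Dense`. Mathlib has no Wightman distributions, no kernel theorem and no reconstruction theorem
(searched `Wightman`, `nuclear`, `kernel theorem`, `Reeh`: no hits in `Mathlib/Analysis`).

## Design choices

* `WightmanFamily d κ := (n : ℕ) → (Fin n → κ) → 𝓢((Fin n → SpaceTime d), ℂ) →L[ℂ] ℂ`; for a
  single species (`κ = Unit`) this is literally `fun n _ ↦ S n` for an
  `AQFT.SchwingerFamily (SpaceTime d)` — same carrier `(ℝ^{1+d})^n`, read with the Minkowski
  metric (time = coordinate `0`).
* All tensor products enter through the accepted witness predicates `AQFT.IsTensorOf`,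
  `AQFT.IsAppendTensorOf` (outline A-D1), exactly as in the accepted `SchwingerOSAxioms`.
* Positivity is stated for finite families indexed by `i : Fin N` with *arbitrary* degrees
  `deg i` and labels `lab i` (rather than degree `= i`): with several species `κ` the test
  vectors `∑ᵢ φ_{lab i}(Fᵢ) Ω` must be allowed to mix label tuples of the same degree, otherwise
  the condition is too weak for reconstruction. For `κ = Unit` it is equivalent to SW (3-29).
* The spectral condition is phrased on the test-function side: `𝒲ₙ(F) = 0` whenever the
  Fourier transform of (the flattening of) `F` is supported away from the spectral set
  (SW (3-13) in the partial-sum variables). Sign convention (outline flag, *resolved*):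
  Mathlib's `𝓕` uses the kernel `e^{-2πi⟪x, ξ⟫}` with the *Euclidean* inner product on the
  flattening (`⟪x, ξ⟫ = ∑ⱼ ⟪xⱼ, ξⱼ⟫`), and the accepted `IsWightmanQFT.spectral` (G07
  `HasFourierSpectrumIn`) fixes `U(a) = ∫ e^{+i⟪p, a⟫} dE(p)` with Euclidean pairing and
  `supp E ⊆ V̄₊`. Then `𝒲ₙ(F) = ∫ (𝓕 F)(−p/2π) dν(p)` with `∑_{j≤k} (−pⱼ) ∈ V̄₊`, i.e. `𝒲ₙ(F) = 0`
  whenever `tsupport (𝓕 F)` misses `+spectralSet` (a cone, so the `2π` is irrelevant). Hence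
  the `+spectralSet` form below is the one forced by the accepted conventions, and
  `IsWightmanQFT.isWightmanFamily` (b) is true as stated.
* Reconstruction (SW Thm. 3-7) produces, and is unique among, QFTs whose domain `D` *is* the
  polynomial domain `D₀ = span {φ(f₁)⋯φ(fₙ)Ω}`; since the accepted
  `WightmanData.IsUnitarilyEquivalent` maps domain onto domain, the uniqueness clause of
  `wightman_reconstruction` is restricted to `WightmanData.HasMinimalDomain` (this predicate
  coincides with `WightmanData.HasPolynomialDomain` of `Statements/ConstructiveQFT/Wightman`,
  which a prelude module cannot import; the name is kept distinct to avoid a clash). The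
  theorem binds `κ : Type` because `WightmanData.H : Type` (a `Type`-sized Hilbert space cannot
  carry independent fields indexed by a large `κ`).
* Locality is the bosonic (commuting) form for scalar fields, as in the accepted
  `IsWightmanQFT.locality`.
-/

noncomputable section

open Filter Topology ComplexConjugate
open scoped InnerProductSpace SchwartzMap FourierTransform ComplexOrder
open Literature.MathematicalPhysics.QuantumLattice

namespace Literature.Analysis.FunctionSpaces

variable {d : ℕ} {κ : Type*}

/-! ### The carrier and the flattening -/

/-- A **family of Wightman distributions** on `(d+1)`-dimensional Minkowski space with field
labels in `κ`: for each `n` and each label tuple `k : Fin n → κ` a tempered distribution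
`𝒲ₙ^{(k)} ∈ 𝒮'((ℝ^{1+d})^n)`, i.e. a continuous linear functional on
`𝓢((Fin n → SpaceTime d), ℂ)` (Streater–Wightman (1964), §3-3, eq. (3-11)). For `κ = Unit` this
is `fun n _ ↦ S n` of an `AQFT.SchwingerFamily (SpaceTime d)`. [cite: StreaterWightman1964] -/
abbrev WightmanFamily (d : ℕ) (κ : Type*) : Type _ :=
  (n : ℕ) → (Fin n → κ) → 𝓢((Fin n → SpaceTime d), ℂ) →L[ℂ] ℂ

variable (d) in
/-- The flattening `(ℝ^{1+d})^n ≃ ℝ^{n(1+d)}` as a *linear* equivalence: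
`x ↦ ((i, μ) ↦ (x i) μ)` (uncurrying composed with the `WithLp` identifications). Auxiliary for
`flattenCLE`. [folklore] -/
def flattenLinearEquiv (n : ℕ) :
    (Fin n → SpaceTime d) ≃ₗ[ℝ] EuclideanSpace ℝ (Fin n × Fin (d + 1)) :=
  (LinearEquiv.piCongrRight fun _ : Fin n => WithLp.linearEquiv 2 ℝ (Fin (d + 1) → ℝ)) ≪≫ₗ
    (LinearEquiv.curry ℝ ℝ (Fin n) (Fin (d + 1))).symm ≪≫ₗ
      (WithLp.linearEquiv 2 ℝ (Fin n × Fin (d + 1) → ℝ)).symm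

variable (d) in
/-- The flattening `(ℝ^{1+d})^n ≃L ℝ^{n(1+d)}`, `x ↦ ((i, μ) ↦ (x i) μ)`, as a continuous linear
equivalence onto the Euclidean space `EuclideanSpace ℝ (Fin n × Fin (d + 1))` (an inner-product
space, so that Mathlib's Fourier transform on Schwartz space applies). Real definition:
`LinearEquiv.toContinuousLinearEquiv` of `flattenLinearEquiv` (finite dimension)
(bookkeeping for Streater–Wightman (1964), §3-3, eq. (3-12)). [cite: StreaterWightman1964] -/
def flattenCLE (n : ℕ) : (Fin n → SpaceTime d) ≃L[ℝ] EuclideanSpace ℝ (Fin n × Fin (d + 1)) :=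
  (flattenLinearEquiv d n).toContinuousLinearEquiv

/-- Pointwise formula: `flattenCLE d n x (i, μ) = x i μ`. [folklore] -/
@[simp]
theorem flattenCLE_apply (n : ℕ) (x : Fin n → SpaceTime d) (p : Fin n × Fin (d + 1)) :
    flattenCLE d n x p = x p.1 p.2 := rfl

/-- Pointwise formula for the inverse: `(flattenCLE d n).symm y i μ = y (i, μ)`. [folklore] -/
@[simp]
theorem flattenCLE_symm_apply (n : ℕ) (y : EuclideanSpace ℝ (Fin n × Fin (d + 1))) (i : Fin n)
    (μ : Fin (d + 1)) : (flattenCLE d n).symm y i μ = y (i, μ) := rfl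

variable {n : ℕ}

/-- Transport of `n`-point test functions to the flattened Euclidean space,
`flattenTest F = F ∘ (flattenCLE d n)⁻¹ ∈ 𝓢(ℝ^{n(1+d)}, ℂ)` (Mathlib
`SchwartzMap.compCLMOfContinuousLinearEquiv`; bookkeeping for the Fourier transform in
Streater–Wightman (1964), §3-3, eq. (3-12)). [cite: StreaterWightman1964] -/
def flattenTest :
    𝓢((Fin n → SpaceTime d), ℂ) →L[ℂ] 𝓢(EuclideanSpace ℝ (Fin n × Fin (d + 1)), ℂ) :=
  SchwartzMap.compCLMOfContinuousLinearEquiv ℂ (flattenCLE d n).symm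

/-- `flattenTest F y = F ((flattenCLE d n).symm y)`. [folklore] -/
@[simp]
theorem flattenTest_apply (F : 𝓢((Fin n → SpaceTime d), ℂ))
    (y : EuclideanSpace ℝ (Fin n × Fin (d + 1))) :
    flattenTest F y = F ((flattenCLE d n).symm y) := rfl

variable (d n) in
/-- The **spectral set** of the `n`-point Wightman distribution in momentum variables
`p = (p₁, …, pₙ)`: total momentum zero, `∑ⱼ pⱼ = 0` (translation invariance), and every partial
sum `qₖ = ∑_{j ≤ k} pⱼ` in the closed forward cone `V̄₊` (Streater–Wightman (1964), §3-3,
eq. (3-13), written in the momenta `pⱼ` conjugate to the points `xⱼ` rather than in the momenta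
`qₖ` conjugate to the difference variables `ξₖ = xₖ − x_{k+1}`). Sign: with Mathlib's Fourier
kernel `e^{-2πi⟪x, ξ⟫}` (Euclidean pairing) and the accepted `e^{+i⟪p, a⟫}` convention of
`IsWightmanQFT.spectral`, the Fourier transform of a Wightman test function is tested against
`+spectralSet` (derivation in the module docstring). [cite: StreaterWightman1964] -/
def spectralSet : Set (Fin n → SpaceTime d) :=
  {p | ∑ j, p j = 0 ∧ ∀ k : Fin n, (∑ j ∈ Finset.Iic k, p j) ∈ closedForwardCone d}

/-- Membership in the spectral set. [folklore] -/
@[simp]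
theorem mem_spectralSet_iff (p : Fin n → SpaceTime d) :
    p ∈ spectralSet d n ↔
      ∑ j, p j = 0 ∧ ∀ k : Fin n, (∑ j ∈ Finset.Iic k, p j) ∈ closedForwardCone d :=
  Iff.rfl

/-- `0 ∈ spectralSet d n` (the vacuum contribution). [folklore] -/
theorem zero_mem_spectralSet : (0 : Fin n → SpaceTime d) ∈ spectralSet d n := by
  refine ⟨by simp, fun k => ?_⟩
  simp [mem_closedForwardCone_iff]

/-! ### The Streater–Wightman properties of a family of distributions -/

section Props

/-- **(a) Relativistic invariance** of a family of Wightman distributions: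
`𝒲ₙ(g • F) = 𝒲ₙ(F)` for every `g` in the restricted Poincaré group acting diagonally,
`(g • F)(x₁, …, xₙ) = F(g⁻¹ x₁, …, g⁻¹ xₙ)` (accepted `poincareTestMulti`)
(Streater–Wightman (1964), §3-3, eq. (3-21); scalar fields). [cite: StreaterWightman1964] -/
def IsPoincareInvariantFamily (𝒲 : WightmanFamily d κ) : Prop :=
  ∀ (g : PoincareGroup d) (n : ℕ) (k : Fin n → κ) (F : 𝓢((Fin n → SpaceTime d), ℂ)),
    𝒲 n k (poincareTestMulti n g F) = 𝒲 n k F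

/-- **(b) Spectral condition** for a family of Wightman distributions: the Fourier transform of
`𝒲ₙ` is supported in the spectral set `{∑ pⱼ = 0, ∑_{j≤k} pⱼ ∈ V̄₊}`; on the test-function side,
`𝒲ₙ(F) = 0` whenever the Fourier transform of (the flattening of) `F` has support disjoint from
(the flattening of) `spectralSet d n` (Streater–Wightman (1964), §3-3, eq. (3-13) and
Thm. 3-2). The sign (`+spectralSet`) is the one forced by Mathlib's `𝓕` and the accepted
`IsWightmanQFT.spectral` convention `U(a) = ∫ e^{+i⟪p, a⟫} dE(p)`; see the module docstring. [cite: StreaterWightman1964] -/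
def HasSpectralCondition (𝒲 : WightmanFamily d κ) : Prop :=
  ∀ (n : ℕ) (k : Fin n → κ) (F : 𝓢((Fin n → SpaceTime d), ℂ)),
    Disjoint (tsupport (⇑(SchwartzMap.fourierTransformCLM ℂ (flattenTest F))))
        (flattenCLE d n '' spectralSet d n) →
      𝒲 n k F = 0

/-- **(c) Hermiticity** of a family of Wightman distributions:
`𝒲ₙ^{(kₙ, …, k₁)}(F*) = conj 𝒲ₙ^{(k₁, …, kₙ)}(F)` with `F*(x₁, …, xₙ) = conj F(xₙ, …, x₁)`, i.e.
`F* = starTest (permTest Fin.revPerm F)` (Streater–Wightman (1964), §3-3, eq. (3-25)). [cite: StreaterWightman1964] -/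
def IsHermitianFamily (𝒲 : WightmanFamily d κ) : Prop :=
  ∀ (n : ℕ) (k : Fin n → κ) (F : 𝓢((Fin n → SpaceTime d), ℂ)),
    𝒲 n (k ∘ Fin.rev) (starTest (permTest Fin.revPerm F)) = conj (𝒲 n k F)

/-- **(d) Local commutativity** of a family of Wightman distributions (bosonic statistics,
scalar fields): if the `j`-th and `(j+1)`-st one-point test functions have spacelike-separated
supports, then swapping them (together with their labels) does not change
`𝒲ₙ(f₁ ⊗ ⋯ ⊗ fⱼ ⊗ f_{j+1} ⊗ ⋯ ⊗ fₙ)`; tensor products in witness form `AQFT.IsTensorOf`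
(Streater–Wightman (1964), §3-3, eq. (3-26)–(3-27)). [cite: StreaterWightman1964] -/
def IsLocalFamily (𝒲 : WightmanFamily d κ) : Prop :=
  ∀ (n : ℕ) (k : Fin n → κ) (f : Fin n → 𝓢(SpaceTime d, ℂ)) (j : Fin n) (hj : j.val + 1 < n)
    (F F' : 𝓢((Fin n → SpaceTime d), ℂ)),
    IsTensorOf F f → IsTensorOf F' (f ∘ Equiv.swap j ⟨j.val + 1, hj⟩) →
      AreSpacelikeSeparated (tsupport (f j)) (tsupport (f ⟨j.val + 1, hj⟩)) →
        𝒲 n k F = 𝒲 n (k ∘ Equiv.swap j ⟨j.val + 1, hj⟩) F'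

/-- **(e) Positive definiteness** (Wightman positivity) of a family of Wightman distributions:
for every finite family `(Fᵢ)_{i < N}` of test functions `Fᵢ ∈ 𝓢((ℝ^{1+d})^{deg i})` with label
tuples `lab i`, `∑ᵢ ∑ⱼ 𝒲_{deg i + deg j}^{(rev (lab i), lab j)}(Fᵢ* ⊗ Fⱼ) ≥ 0`, where
`Fᵢ* = starTest (permTest Fin.revPerm Fᵢ)` and the tensor products `Fᵢ* ⊗ Fⱼ` are any witnesses
`G i j` in the sense of `AQFT.IsAppendTensorOf`; "`0 ≤ z`" for `z : ℂ` is Mathlib's partial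
order on `ℂ` (`Complex.le_def`: `0 ≤ z.re ∧ z.im = 0`; scope `ComplexOrder`)
(Streater–Wightman (1964), §3-4, eq. (3-29): this is
`‖∑ᵢ φ_{lab i}(Fᵢ) Ω‖² ≥ 0`). Degrees and labels are arbitrary per index so that vectors mixing
several label tuples of the same degree are covered (module docstring). [cite: StreaterWightman1964] -/
def IsPositiveDefiniteFamily (𝒲 : WightmanFamily d κ) : Prop :=
  ∀ (N : ℕ) (deg : Fin N → ℕ) (lab : (i : Fin N) → Fin (deg i) → κ)
    (F : (i : Fin N) → 𝓢((Fin (deg i) → SpaceTime d), ℂ))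
    (G : (i j : Fin N) → 𝓢((Fin (deg i + deg j) → SpaceTime d), ℂ)),
    (∀ i j, IsAppendTensorOf (G i j) (starTest (permTest Fin.revPerm (F i))) (F j)) →
      (0 : ℂ) ≤ ∑ i, ∑ j, 𝒲 (deg i + deg j) (Fin.append (lab i ∘ Fin.rev) (lab j)) (G i j)

/-- **(f) Cluster decomposition property** of a family of Wightman distributions: for a
spacelike vector `a`, `𝒲_{n+m}(F ⊗ G_{(λa)}) → 𝒲ₙ(F) 𝒲ₘ(G)` as `λ → ∞`, where
`G_{(λa)} = translateMulti (λ • a) G` is `G` translated by `λ a` in every argument and the tensor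
products are any witnesses `H λ` in the sense of `AQFT.IsAppendTensorOf`
(Streater–Wightman (1964), §3-4, eq. (3-31)). [cite: StreaterWightman1964] -/
def HasClusterProperty (𝒲 : WightmanFamily d κ) : Prop :=
  ∀ (n m : ℕ) (kn : Fin n → κ) (km : Fin m → κ) (F : 𝓢((Fin n → SpaceTime d), ℂ))
    (G : 𝓢((Fin m → SpaceTime d), ℂ)) (a : SpaceTime d), IsSpacelike a →
      ∀ H : ℝ → 𝓢((Fin (n + m) → SpaceTime d), ℂ),
        (∀ t, IsAppendTensorOf (H t) F (translateMulti (t • a) G)) →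
          Tendsto (fun t : ℝ => 𝒲 (n + m) (Fin.append kn km) (H t)) atTop
            (𝓝 (𝒲 n kn F * 𝒲 m km G))

/-- **Normalisation** `𝒲₀ = 1`: the zero-point distribution is evaluation at the unique point
(the empty tuple, `default`) of `Fin 0 → SpaceTime d`, i.e. `𝒲₀ = ⟪Ω, Ω⟫ = 1`
(Streater–Wightman (1964), §3-3, `𝒲₀ = 1` below eq. (3-11)). [cite: StreaterWightman1964] -/
def IsNormalisedFamily (𝒲 : WightmanFamily d κ) : Prop :=
  ∀ (k : Fin 0 → κ) (F : 𝓢((Fin 0 → SpaceTime d), ℂ)), 𝒲 0 k F = F default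

/-- A family of tempered distributions `𝒲` **has the Wightman properties** (a)–(f) of
Streater–Wightman (1964), §3-3/§3-4, together with the normalisation `𝒲₀ = 1`: the hypotheses
of the Wightman reconstruction theorem (Thm. 3-7). [cite: StreaterWightman1964] -/
structure IsWightmanFamily (𝒲 : WightmanFamily d κ) : Prop where
  /-- (a) Poincaré invariance, SW (3-21). -/
  poincare_invariant : IsPoincareInvariantFamily 𝒲
  /-- (b) spectral condition, SW (3-13). -/
  spectral : HasSpectralCondition 𝒲
  /-- (c) hermiticity, SW (3-25). -/
  hermitian : IsHermitianFamily 𝒲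
  /-- (d) local commutativity, SW (3-27). -/
  local_comm : IsLocalFamily 𝒲
  /-- (e) positive definiteness, SW (3-29). -/
  positive : IsPositiveDefiniteFamily 𝒲
  /-- (f) cluster decomposition property, SW (3-31). -/
  cluster : HasClusterProperty 𝒲
  /-- normalisation `𝒲₀ = 1`. -/
  normalised : IsNormalisedFamily 𝒲

end Props

/-! ### API: translation invariance -/

/-- A pure translation acts on `n`-point test functions as the diagonal translation:
`poincareTestMulti n (a, 1) F = translateMulti a F`. [folklore] -/
theorem poincareTestMulti_inl (n : ℕ) (a : SpaceTime d) (F : 𝓢((Fin n → SpaceTime d), ℂ)) :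
    poincareTestMulti n (SemidirectProduct.inl (Multiplicative.ofAdd a) : PoincareGroup d) F =
      translateMulti a F := by
  ext x
  simp only [poincareTestMulti_apply, translateMulti_apply, SemidirectProduct.left_inl,
    SemidirectProduct.right_inl, toAdd_ofAdd]
  rfl

/-- **Translation invariance** of a Poincaré-invariant family:
`𝒲ₙ(F(· − a, …, · − a)) = 𝒲ₙ(F)` (Streater–Wightman (1964), §3-3, eq. (3-21) with `Λ = 1`;
the special case `g = (a, 1)` of `IsPoincareInvariantFamily`). [cite: StreaterWightman1964] -/
theorem IsPoincareInvariantFamily.translation_invariant {𝒲 : WightmanFamily d κ}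
    (h : IsPoincareInvariantFamily 𝒲) (n : ℕ) (k : Fin n → κ) (a : SpaceTime d)
    (F : 𝓢((Fin n → SpaceTime d), ℂ)) : 𝒲 n k (translateMulti a F) = 𝒲 n k F := by
  rw [← poincareTestMulti_inl n a F]
  exact h _ n k F

/-- **Translation invariance** of a Wightman family (from property (a);
Streater–Wightman (1964), §3-3, eq. (3-21)). [cite: StreaterWightman1964] -/
theorem IsWightmanFamily.translation_invariant {𝒲 : WightmanFamily d κ}
    (h : IsWightmanFamily 𝒲) (n : ℕ) (k : Fin n → κ) (a : SpaceTime d)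
    (F : 𝓢((Fin n → SpaceTime d), ℂ)) : 𝒲 n k (translateMulti a F) = 𝒲 n k F :=
  h.poincare_invariant.translation_invariant n k a F

/-! ### The Wightman distributions of a Wightman QFT -/

section QFT

/-- The Wightman data `W` **have minimal (polynomial) domain**: the chosen common domain `D`
*is* the polynomial domain `D₀ = span {φ_{k₁}(f₁) ⋯ φ_{kₙ}(fₙ) Ω}` (Streater–Wightman (1964),
§3-4: the domain produced by the reconstruction theorem, Thm. 3-7, and the class within which
the reconstructed theory is unique up to unitary equivalence). Coincides with
`WightmanData.HasPolynomialDomain` of `Statements/ConstructiveQFT/Wightman` (not importable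
from a prelude module). [cite: StreaterWightman1964] -/
def _root_.Literature.MathematicalPhysics.QuantumLattice.WightmanData.HasMinimalDomain (W : WightmanData d κ) : Prop :=
  W.dom = Submodule.span ℂ (Set.range fun l : List (κ × 𝓢(SpaceTime d, ℂ)) =>
    (W.fieldMonomial l W.vacuumDom : W.H))

/-- The polynomial domain is always contained in `D` (each monomial maps `D → D`), so
`HasMinimalDomain` is equivalent to the inclusion `D ≤ D₀`. [folklore] -/
theorem _root_.Literature.MathematicalPhysics.QuantumLattice.WightmanData.hasMinimalDomain_iff (W : WightmanData d κ) :
    W.HasMinimalDomain ↔ W.dom ≤ Submodule.span ℂ (Set.range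
      fun l : List (κ × 𝓢(SpaceTime d, ℂ)) => (W.fieldMonomial l W.vacuumDom : W.H)) := by
  refine ⟨fun h => h.le, fun h => le_antisymm h (Submodule.span_le.2 ?_)⟩
  rintro _ ⟨l, rfl⟩
  exact (W.fieldMonomial l W.vacuumDom).2

variable {W : WightmanData d κ}

/-- **Existence and uniqueness of the Wightman distributions** (Streater–Wightman (1964),
Thm. 2-1 (Schwartz nuclear theorem) and §3-3, eqs. (3-9)–(3-11)): for a Wightman QFT the
separately continuous multilinear functionals `(f₁, …, fₙ) ↦ ⟪Ω, φ_{k₁}(f₁) ⋯ φ_{kₙ}(fₙ) Ω⟫`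
extend uniquely to tempered distributions `𝒲ₙ^{(k)}` on `(ℝ^{1+d})^n` with
`𝒲ₙ^{(k)}(f₁ ⊗ ⋯ ⊗ fₙ) = ⟪Ω, φ_{k₁}(f₁) ⋯ φ_{kₙ}(fₙ) Ω⟫`. Known theorem; proof deferred. [cite: StreaterWightman1964] -/
def _root_.Literature.MathematicalPhysics.QuantumLattice.IsWightmanQFT.existsUnique_wightmanFamily : Prop :=
  ∀ (hW : IsWightmanQFT W),
    ∃! 𝒲 : WightmanFamily d κ, ∀ (n : ℕ) (k : Fin n → κ),
      IsWightmanDistributionOf W n k (𝒲 n k)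

/-- **The Wightman distributions of a Wightman QFT have properties (a)–(f)**
(Streater–Wightman (1964), §3-3, Thms. 3-1 (invariance, from W2), 3-2 (spectral condition,
from W0), 3-3 (hermiticity and local commutativity, from W1/W3), §3-4, Thm. 3-4 (positive
definiteness and cluster property), and `𝒲₀ = ‖Ω‖² = 1`). Known theorem; proof deferred. [cite: StreaterWightman1964] -/
def _root_.Literature.MathematicalPhysics.QuantumLattice.IsWightmanQFT.isWightmanFamily : Prop :=
  ∀ (hW : IsWightmanQFT W) {𝒲 : WightmanFamily d κ} (h𝒲 : ∀ (n : ℕ) (k : Fin n → κ), IsWightmanDistributionOf W n k (𝒲 n k)),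
    IsWightmanFamily 𝒲

/-- **The Wightman reconstruction theorem** (Streater–Wightman (1964), §3-4, Thm. 3-7;
Wightman, Phys. Rev. 101 (1956) 860). A family of tempered distributions `𝒲ₙ^{(k)}` with the
properties (a) relativistic invariance, (b) spectral condition, (c) hermiticity, (d) local
commutativity, (e) positive definiteness, (f) cluster decomposition (and `𝒲₀ = 1`) is the family
of Wightman distributions of a Wightman QFT of hermitian scalar fields (`IsWightmanQFT`, W0–W4
including uniqueness of the vacuum) whose domain is the polynomial domain
`D₀ = span {φ(f₁)⋯φ(fₙ)Ω}` (`WightmanData.HasMinimalDomain`), and any two such QFTs on their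
polynomial domains are unitarily equivalent (`WightmanData.IsUnitarilyEquivalent`, which maps
domain onto domain — hence the restriction to minimal domains, exactly as in SW Thm. 3-7). The
label type is `κ : Type` since the Hilbert space `WightmanData.H : Type` must carry the vectors
`φ_k(f) Ω`, `k : κ`. Known theorem; proof deferred. [cite: StreaterWightman1964] -/
def wightman_reconstruction : Prop :=
  ∀ {κ : Type} {𝒲 : WightmanFamily d κ} (h : IsWightmanFamily 𝒲),
    ∃ W : WightmanData d κ, IsWightmanQFT W ∧ W.HasMinimalDomain ∧
      (∀ (n : ℕ) (k : Fin n → κ), IsWightmanDistributionOf W n k (𝒲 n k)) ∧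
      ∀ W' : WightmanData d κ, IsWightmanQFT W' → W'.HasMinimalDomain →
        (∀ (n : ℕ) (k : Fin n → κ), IsWightmanDistributionOf W' n k (𝒲 n k)) →
          W.IsUnitarilyEquivalent W'

/-- **The Reeh–Schlieder theorem** (Reeh–Schlieder (1961); Streater–Wightman (1964), §4-2,
Thm. 4-2): in a Wightman QFT, for every nonempty open region `O` of space-time the vectors
`φ_{k₁}(f₁) ⋯ φ_{kₙ}(fₙ) Ω` with all `fᵢ ∈ 𝒟(O)` (compactly supported, `supp fᵢ ⊆ O`) already
span a dense subspace of `H` (the vacuum is cyclic for the polynomial algebra of any open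
region; compare W4 = `IsWightmanQFT.cyclic`, whose generating set is larger). Known theorem;
proof deferred. [cite: ReehSchlieder1961] -/
def reeh_schlieder : Prop :=
  ∀ (hW : IsWightmanQFT W) {O : Set (SpaceTime d)} (hO : IsOpen O) (hne : O.Nonempty),
    Dense (Submodule.span ℂ {ψ : W.H | ∃ l : List (κ × 𝓢(SpaceTime d, ℂ)),
      (∀ p ∈ l, HasCompactSupport (p.2 : SpaceTime d → ℂ) ∧
        tsupport (p.2 : SpaceTime d → ℂ) ⊆ O) ∧
        ψ = (W.fieldMonomial l W.vacuumDom : W.H)} : Set W.H)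

end QFT

end Literature.Analysis.FunctionSpaces
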